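import Mathlib
import Summits.RiemannHypothesis.RiemannHypothesis.Theorems.WeilFarCoercivityFloor
import HarnessLib

/-!
# The RMS envelope dominates every shift correlation: `Q_a(g) ≤ Q_{a+h}((φ ∗ g²)^{1/2})`

Helper file (`--supports stmt-RiemannHypothesis-0098`, lead-track anchor: Weil-positivity window ladder, format-C far bound),
pure proofs, RH-free.  Seat rh-explicit-weil-1 gen11 (memo `run/shared/lean/pub/rh-explicit/rh-explicit-weil-1/FORMAT-K3.md` §12.6).

THE LEMMA.  Let `g` be an admissible window function on `[−a, a]` (real, measurable, bounded, vanishing off the window) and `φ ≥ 0` a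
bounded measurable weight vanishing off `[−h, h]` with `∫ φ = 1`.  The ROOT-MEAN-SQUARE ENVELOPE `G(x) = (∫ φ(z) g(x − z)² dz)^{1/2}` is
admissible on the window `[−a−h, a+h]` with the same bound and THE SAME NORM (`integral_envelope_sq`: `∫ G² = ∫ g²`), and it DOMINATES EVERY
SHIFT CORRELATION of `g` (`integral_shift_mul_le_envelope`):

  `∫ g(x − ℓ) g(x) dx ≤ ∫ G(x − ℓ) G(x) dx`   for every real `ℓ`

(pointwise Cauchy–Schwarz in `L²(φ dz)`: `(φ∗g²)(x − ℓ)·(φ∗g²)(x) ≥ (∫ φ(z) g(x−ℓ−z) g(x−z) dz)²`, then Fubini and translation invariance).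
Since the prime-shift form `Q_a = primeShiftForm a` has nonnegative weights `2Λ(n)/√n`, **`Q_a(g) ≤ Q_{a+h}(G)`** (`primeShiftForm_le_envelope`):
every window function — however rough (cf. the resonant modulations of `WeilFarFloorNoSpectralGap`, whose envelope is the cosh profile again) —
is dominated shift by shift by a NONNEGATIVE function whose small-scale regularity is that of `φ` (`D_t(G) ≤ ‖τ_tφ − φ‖₁·∫g²` since
`|√A − √B|² ≤ |A − B|`; kernel version in a sequel), at the price of widening the window by `h` (`quotient_le_envelope_quotient`).

WHY (FORMAT-K3 §12.6).  With the RH anatomy of `WeilFarFloorRHCeiling` (`Q ≤ POLE − (2I₀+log 4π+γ)‖·‖² + ∫ρ_∞D_t`) applied to the envelope at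
scale `h = e^{−a}` this gives, on paper, `λ_max(a) ≤ e^a + 3a − 0.41` under RH — the floor law C-XIII up to a LINEAR term (gen9's staged S5 has
`e^a + O(a²e^{a/2})`); the kernel version of that step needs the anatomy inequality for non-smooth admissible functions (mollification) and is
left to the successor.  This file is the unconditional, elementary half.  Standard axioms only.
-/

set_option linter.dupNamespace false
set_option autoImplicit false

noncomputable section

open MeasureTheory Set Filter
open scoped Real Topology ArithmeticFunction.vonMangoldt

namespace Summit.RiemannHypothesis.RiemannHypothesis.Theorems.WeilFormatC

namespace FloorEnvelope

open Literature.NumberTheory.LFunctions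

variable {a h : ℝ} {g φ : ℝ → ℝ} {C Cφ : ℝ}

/-! ## §1 The weighted square integrand and its integrability -/

/-- The weight times a shifted square is integrable in the weight variable (bounded, vanishing off `[−h, h]`). -/
theorem integrable_weight_mul_sq (hg : Measurable g) (hC : ∀ x, |g x| ≤ C)
    (hφm : Measurable φ) (hφ0 : ∀ z, 0 ≤ φ z) (hφC : ∀ z, φ z ≤ Cφ) (hφs : ∀ z, z ∉ Icc (-h) h → φ z = 0) (x : ℝ) :
    Integrable (fun z ↦ φ z * g (x - z) ^ 2) := by
  have hC0 : 0 ≤ C := (abs_nonneg _).trans (hC 0)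
  have hint : Integrable ((Icc (-h) h).indicator fun _ : ℝ ↦ Cφ * C ^ 2) :=
    (integrable_indicator_iff measurableSet_Icc).2 (integrableOn_const (by simp [Real.volume_Icc]))
  refine hint.mono' ((hφm.mul ((hg.comp (measurable_const.sub measurable_id)).pow_const 2)).aestronglyMeasurable)
    (Eventually.of_forall fun z ↦ ?_)
  by_cases hz : z ∈ Icc (-h) h
  · rw [indicator_of_mem hz, Real.norm_eq_abs, abs_mul, abs_of_nonneg (hφ0 z), abs_of_nonneg (sq_nonneg _)]
    have h1 : g (x - z) ^ 2 ≤ C ^ 2 := by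
      have := hC (x - z)
      rw [← sq_abs]; exact pow_le_pow_left₀ (abs_nonneg _) this 2
    exact mul_le_mul (hφC z) h1 (sq_nonneg _) ((hφ0 z).trans (hφC z))
  · rw [indicator_of_notMem hz, hφs z hz, zero_mul, norm_zero]

/-- The weighted mean square is nonnegative. -/
theorem weightedSq_nonneg (hφ0 : ∀ z, 0 ≤ φ z) (x : ℝ) : 0 ≤ ∫ z, φ z * g (x - z) ^ 2 :=
  integral_nonneg fun z ↦ mul_nonneg (hφ0 z) (sq_nonneg _)

/-- The weighted mean square is at most `C²` when `|g| ≤ C` and `∫ φ = 1`. -/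
theorem weightedSq_le (hg : Measurable g) (hC : ∀ x, |g x| ≤ C)
    (hφm : Measurable φ) (hφ0 : ∀ z, 0 ≤ φ z) (hφC : ∀ z, φ z ≤ Cφ) (hφs : ∀ z, z ∉ Icc (-h) h → φ z = 0)
    (hφ1 : ∫ z, φ z = 1) (x : ℝ) :
    ∫ z, φ z * g (x - z) ^ 2 ≤ C ^ 2 := by
  have hφi : Integrable φ := by
    by_contra hni
    rw [integral_undef hni] at hφ1; exact zero_ne_one hφ1
  calc ∫ z, φ z * g (x - z) ^ 2 ≤ ∫ z, φ z * C ^ 2 := by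
        refine integral_mono (integrable_weight_mul_sq hg hC hφm hφ0 hφC hφs x) (hφi.mul_const _) fun z ↦ ?_
        refine mul_le_mul_of_nonneg_left ?_ (hφ0 z)
        have := hC (x - z)
        rw [← sq_abs]; exact pow_le_pow_left₀ (abs_nonneg _) this 2
    _ = C ^ 2 := by rw [integral_mul_const, hφ1, one_mul]

/-- Off the widened window `[−a−h, a+h]` the weighted mean square vanishes. -/
theorem weightedSq_eq_zero (hsupp : ∀ x, x ∉ Icc (-a) a → g x = 0) (hφs : ∀ z, z ∉ Icc (-h) h → φ z = 0)
    {x : ℝ} (hx : x ∉ Icc (-a - h) (a + h)) : ∫ z, φ z * g (x - z) ^ 2 = 0 := by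
  refine integral_eq_zero_of_ae (Eventually.of_forall fun z ↦ ?_)
  by_cases hz : z ∈ Icc (-h) h
  · have hxz : x - z ∉ Icc (-a) a := by
      intro hmem
      exact hx ⟨by linarith [hmem.1, hz.1], by linarith [hmem.2, hz.2]⟩
    simp [hsupp _ hxz]
  · simp [hφs z hz]

/-- Joint measurability of `(x, z) ↦ φ(z) g(x − z)²`. -/
theorem measurable_weight_mul_sq_uncurry (hg : Measurable g) (hφm : Measurable φ) :
    Measurable (fun p : ℝ × ℝ ↦ φ p.2 * g (p.1 - p.2) ^ 2) :=
  (hφm.comp measurable_snd).mul ((hg.comp (measurable_fst.sub measurable_snd)).pow_const 2)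

/-- The weighted mean square is a measurable function of `x`. -/
theorem measurable_weightedSq (hg : Measurable g) (hφm : Measurable φ) :
    Measurable (fun x ↦ ∫ z, φ z * g (x - z) ^ 2) := by
  have h := (measurable_weight_mul_sq_uncurry hg hφm).stronglyMeasurable
  exact (MeasureTheory.StronglyMeasurable.integral_prod_right'
    (f := fun p : ℝ × ℝ ↦ φ p.2 * g (p.1 - p.2) ^ 2) h).measurable

/-! ## §2 The envelope is admissible on the widened window, with the same norm -/

/-- **The envelope is admissible**: `G = (φ ∗ g²)^{1/2}` is measurable, nonnegative, bounded by the bound of `g`, and vanishes off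
`[−(a+h), a+h]`. -/
theorem envelope_admissible (hg : Measurable g) (hC : ∀ x, |g x| ≤ C) (hsupp : ∀ x, x ∉ Icc (-a) a → g x = 0)
    (hφm : Measurable φ) (hφ0 : ∀ z, 0 ≤ φ z) (hφC : ∀ z, φ z ≤ Cφ) (hφs : ∀ z, z ∉ Icc (-h) h → φ z = 0)
    (hφ1 : ∫ z, φ z = 1) :
    Measurable (fun x ↦ Real.sqrt (∫ z, φ z * g (x - z) ^ 2)) ∧
      (∀ x, 0 ≤ Real.sqrt (∫ z, φ z * g (x - z) ^ 2)) ∧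
      (∀ x, |Real.sqrt (∫ z, φ z * g (x - z) ^ 2)| ≤ C) ∧
      (∀ x, x ∉ Icc (-(a + h)) (a + h) → Real.sqrt (∫ z, φ z * g (x - z) ^ 2) = 0) := by
  have hC0 : 0 ≤ C := (abs_nonneg _).trans (hC 0)
  refine ⟨(measurable_weightedSq hg hφm).sqrt, fun x ↦ Real.sqrt_nonneg _, fun x ↦ ?_, fun x hx ↦ ?_⟩
  · rw [abs_of_nonneg (Real.sqrt_nonneg _)]
    calc Real.sqrt (∫ z, φ z * g (x - z) ^ 2) ≤ Real.sqrt (C ^ 2) :=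
          Real.sqrt_le_sqrt (weightedSq_le hg hC hφm hφ0 hφC hφs hφ1 x)
      _ = C := Real.sqrt_sq hC0
  · have hx' : x ∉ Icc (-a - h) (a + h) := by rwa [neg_add'] at hx
    rw [weightedSq_eq_zero hsupp hφs hx', Real.sqrt_zero]

/-- Integrability of the joint integrand on `ℝ × ℝ` (bounded, vanishing off a bounded box). -/
theorem integrable_weight_mul_sq_prod (hg : Measurable g) (hC : ∀ x, |g x| ≤ C) (hsupp : ∀ x, x ∉ Icc (-a) a → g x = 0)
    (hφm : Measurable φ) (hφ0 : ∀ z, 0 ≤ φ z) (hφC : ∀ z, φ z ≤ Cφ) (hφs : ∀ z, z ∉ Icc (-h) h → φ z = 0) :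
    Integrable (fun p : ℝ × ℝ ↦ φ p.2 * g (p.1 - p.2) ^ 2) (volume.prod volume) := by
  have hC0 : 0 ≤ C := (abs_nonneg _).trans (hC 0)
  set B : Set (ℝ × ℝ) := Icc (-a - h) (a + h) ×ˢ Icc (-h) h with hB
  have hBm : MeasurableSet B := measurableSet_Icc.prod measurableSet_Icc
  have hBfin : (volume.prod volume) B < ⊤ := by
    rw [hB, Measure.prod_prod, Real.volume_Icc, Real.volume_Icc]
    exact ENNReal.mul_lt_top ENNReal.ofReal_lt_top ENNReal.ofReal_lt_top
  have hint : Integrable (B.indicator fun _ : ℝ × ℝ ↦ Cφ * C ^ 2) (volume.prod volume) :=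
    (integrable_indicator_iff hBm).2 (integrableOn_const hBfin.ne)
  have hnn : 0 ≤ Cφ * C ^ 2 := mul_nonneg (le_trans (hφ0 0) (hφC 0)) (sq_nonneg C)
  have hind0 : ∀ p : ℝ × ℝ, 0 ≤ B.indicator (fun _ : ℝ × ℝ ↦ Cφ * C ^ 2) p := fun p ↦ by
    by_cases hp : p ∈ B
    · rw [indicator_of_mem hp]; exact hnn
    · rw [indicator_of_notMem hp]
  refine hint.mono' (measurable_weight_mul_sq_uncurry hg hφm).aestronglyMeasurable (Eventually.of_forall fun p ↦ ?_)
  by_cases hz : p.2 ∈ Icc (-h) h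
  · by_cases hxz : p.1 - p.2 ∈ Icc (-a) a
    · have hp : p ∈ B := by
        refine ⟨⟨by linarith [hxz.1, hz.1], by linarith [hxz.2, hz.2]⟩, hz⟩
      rw [indicator_of_mem hp, Real.norm_eq_abs, abs_mul, abs_of_nonneg (hφ0 _), abs_of_nonneg (sq_nonneg _)]
      have h1 : g (p.1 - p.2) ^ 2 ≤ C ^ 2 := by
        have := hC (p.1 - p.2)
        rw [← sq_abs]; exact pow_le_pow_left₀ (abs_nonneg _) this 2
      exact mul_le_mul (hφC _) h1 (sq_nonneg _) ((hφ0 0).trans (hφC 0))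
    · rw [hsupp _ hxz]
      simp only [ne_eq, OfNat.ofNat_ne_zero, not_false_eq_true, zero_pow, mul_zero, norm_zero]
      exact hind0 p
  · rw [hφs _ hz, zero_mul, norm_zero]
    exact hind0 p

/-- **The envelope has the norm of `g`**: `∫ G² = ∫ (φ ∗ g²) = (∫φ)·∫g² = ∫ g²`. -/
theorem integral_envelope_sq (hg : Measurable g) (hC : ∀ x, |g x| ≤ C) (hsupp : ∀ x, x ∉ Icc (-a) a → g x = 0)
    (hφm : Measurable φ) (hφ0 : ∀ z, 0 ≤ φ z) (hφC : ∀ z, φ z ≤ Cφ) (hφs : ∀ z, z ∉ Icc (-h) h → φ z = 0)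
    (hφ1 : ∫ z, φ z = 1) :
    ∫ x, Real.sqrt (∫ z, φ z * g (x - z) ^ 2) ^ 2 = ∫ x, g x ^ 2 := by
  have h1 : (fun x ↦ Real.sqrt (∫ z, φ z * g (x - z) ^ 2) ^ 2) = fun x ↦ ∫ z, φ z * g (x - z) ^ 2 :=
    funext fun x ↦ Real.sq_sqrt (weightedSq_nonneg hφ0 x)
  rw [h1, integral_integral_swap (integrable_weight_mul_sq_prod hg hC hsupp hφm hφ0 hφC hφs)]
  have h2 : ∀ z, ∫ x, φ z * g (x - z) ^ 2 = φ z * ∫ x, g x ^ 2 := by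
    intro z
    rw [integral_const_mul]
    congr 1
    exact integral_sub_right_eq_self (fun x ↦ g x ^ 2) z
  simp_rw [h2]
  rw [integral_mul_const, hφ1, one_mul]

/-! ## §3 Domination of every shift correlation (Cauchy–Schwarz in `L²(φ dz)`) -/

/-- Weighted Cauchy–Schwarz in the elementary form `|∫ φuv| ≤ √(∫φu²)·√(∫φv²)` for bounded measurable `u, v` and the weight `φ`. -/
theorem abs_integral_weight_mul_mul_le {u v : ℝ → ℝ} (hu : Measurable u) (hv : Measurable v) {Cu Cv : ℝ}
    (hCu : ∀ z, |u z| ≤ Cu) (hCv : ∀ z, |v z| ≤ Cv)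
    (hφm : Measurable φ) (hφ0 : ∀ z, 0 ≤ φ z) (hφC : ∀ z, φ z ≤ Cφ) (hφs : ∀ z, z ∉ Icc (-h) h → φ z = 0) :
    |∫ z, φ z * (u z * v z)| ≤ Real.sqrt (∫ z, φ z * u z ^ 2) * Real.sqrt (∫ z, φ z * v z ^ 2) := by
  -- integrability of the three weighted products
  have hφi : ∀ {w : ℝ → ℝ} (_ : Measurable w) {Cw : ℝ} (_ : ∀ z, |w z| ≤ Cw), Integrable (fun z ↦ φ z * w z) := by
    intro w hw Cw hCw
    have hint : Integrable ((Icc (-h) h).indicator fun _ : ℝ ↦ Cφ * Cw) :=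
      (integrable_indicator_iff measurableSet_Icc).2 (integrableOn_const (by simp [Real.volume_Icc]))
    refine hint.mono' (hφm.mul hw).aestronglyMeasurable (Eventually.of_forall fun z ↦ ?_)
    by_cases hz : z ∈ Icc (-h) h
    · rw [indicator_of_mem hz, Real.norm_eq_abs, abs_mul, abs_of_nonneg (hφ0 z)]
      exact mul_le_mul (hφC z) (hCw z) (abs_nonneg _) ((hφ0 z).trans (hφC z))
    · rw [indicator_of_notMem hz, hφs z hz, zero_mul, norm_zero]
  have hCu0 : 0 ≤ Cu := (abs_nonneg _).trans (hCu 0)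
  have hCv0 : 0 ≤ Cv := (abs_nonneg _).trans (hCv 0)
  have hbu2 : ∀ z, |u z ^ 2| ≤ Cu ^ 2 := fun z ↦ by
    rw [abs_pow]; exact pow_le_pow_left₀ (abs_nonneg _) (hCu z) 2
  have hbv2 : ∀ z, |v z ^ 2| ≤ Cv ^ 2 := fun z ↦ by
    rw [abs_pow]; exact pow_le_pow_left₀ (abs_nonneg _) (hCv z) 2
  have hbuv : ∀ z, |u z * v z| ≤ Cu * Cv := fun z ↦ by
    rw [abs_mul]; exact mul_le_mul (hCu z) (hCv z) (abs_nonneg _) hCu0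
  have iA := hφi (hu.pow_const 2) hbu2
  have iB := hφi (hu.mul hv) hbuv
  have iC := hφi (hv.pow_const 2) hbv2
  set A := ∫ z, φ z * u z ^ 2 with hA
  set B := ∫ z, φ z * (u z * v z) with hB
  set Cc := ∫ z, φ z * v z ^ 2 with hCc
  have hA0 : 0 ≤ A := integral_nonneg fun z ↦ mul_nonneg (hφ0 z) (sq_nonneg _)
  have hC0 : 0 ≤ Cc := integral_nonneg fun z ↦ mul_nonneg (hφ0 z) (sq_nonneg _)
  -- `0 ≤ ∫ φ (αu + βv)² = α²A + 2αβB + β²Cc`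
  have hnn : ∀ α β : ℝ, 0 ≤ α ^ 2 * A + 2 * α * β * B + β ^ 2 * Cc := by
    intro α β
    have hpt : (fun z ↦ φ z * (α * u z + β * v z) ^ 2)
        = fun z ↦ α ^ 2 * (φ z * u z ^ 2) + 2 * α * β * (φ z * (u z * v z)) + β ^ 2 * (φ z * v z ^ 2) := by
      funext z; ring
    have i1 : Integrable (fun z ↦ α ^ 2 * (φ z * u z ^ 2)) := iA.const_mul _
    have i2 : Integrable (fun z ↦ 2 * α * β * (φ z * (u z * v z))) := iB.const_mul _
    have i12 : Integrable (fun z ↦ α ^ 2 * (φ z * u z ^ 2) + 2 * α * β * (φ z * (u z * v z))) := i1.add i2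
    have i3 : Integrable (fun z ↦ β ^ 2 * (φ z * v z ^ 2)) := iC.const_mul _
    have h0 : 0 ≤ ∫ z, φ z * (α * u z + β * v z) ^ 2 := integral_nonneg fun z ↦ mul_nonneg (hφ0 z) (sq_nonneg _)
    rw [hpt, integral_add i12 i3, integral_add i1 i2, integral_const_mul, integral_const_mul, integral_const_mul] at h0
    rw [hA, hB, hCc]
    exact h0
  -- `B² ≤ A·Cc`
  have hsq : B ^ 2 ≤ A * Cc := by
    rcases hC0.eq_or_lt with hC0' | hCpos
    · -- `Cc = 0`: `A + 2βB ≥ 0` for all `β` forces `B = 0`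
      have hB0 : B = 0 := by
        by_contra hne
        have h1 := hnn 1 (-(A + 1) / (2 * B))
        rw [← hC0', mul_zero, add_zero, one_pow, one_mul] at h1
        have h2 : 2 * 1 * (-(A + 1) / (2 * B)) * B = -(A + 1) := by field_simp
        rw [h2] at h1
        linarith
      rw [hB0, ← hC0']; simp
    · have h1 := hnn Cc (-B)
      -- `Cc²A − 2Cc·B² + B²Cc = Cc(ACc − B²) ≥ 0`
      have h2 : Cc ^ 2 * A + 2 * Cc * -B * B + (-B) ^ 2 * Cc = Cc * (A * Cc - B ^ 2) := by ring
      rw [h2] at h1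
      nlinarith
  calc |B| ≤ Real.sqrt (A * Cc) := Real.abs_le_sqrt hsq
    _ = Real.sqrt A * Real.sqrt Cc := Real.sqrt_mul hA0 Cc

/-- **Pointwise domination**: `G(x − ℓ)·G(x) ≥ ∫ φ(z) g(x−ℓ−z) g(x−z) dz`. -/
theorem integral_weight_shift_mul_le_envelope_mul (hg : Measurable g) (hC : ∀ x, |g x| ≤ C)
    (hφm : Measurable φ) (hφ0 : ∀ z, 0 ≤ φ z) (hφC : ∀ z, φ z ≤ Cφ) (hφs : ∀ z, z ∉ Icc (-h) h → φ z = 0) (x ℓ : ℝ) :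
    ∫ z, φ z * (g (x - ℓ - z) * g (x - z))
      ≤ Real.sqrt (∫ z, φ z * g (x - ℓ - z) ^ 2) * Real.sqrt (∫ z, φ z * g (x - z) ^ 2) :=
  (le_abs_self _).trans (abs_integral_weight_mul_mul_le (hg.comp (measurable_const.sub measurable_id))
    (hg.comp (measurable_const.sub measurable_id)) (fun _ ↦ hC _) (fun _ ↦ hC _) hφm hφ0 hφC hφs)

/-- **The envelope dominates every shift correlation**: `∫ g(x−ℓ)g(x) dx ≤ ∫ G(x−ℓ)G(x) dx` for all `ℓ`. -/
theorem integral_shift_mul_le_envelope (hg : Measurable g) (hC : ∀ x, |g x| ≤ C) (hsupp : ∀ x, x ∉ Icc (-a) a → g x = 0)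
    (hφm : Measurable φ) (hφ0 : ∀ z, 0 ≤ φ z) (hφC : ∀ z, φ z ≤ Cφ) (hφs : ∀ z, z ∉ Icc (-h) h → φ z = 0)
    (hφ1 : ∫ z, φ z = 1) (ℓ : ℝ) :
    ∫ x, g (x - ℓ) * g x
      ≤ ∫ x, Real.sqrt (∫ z, φ z * g (x - ℓ - z) ^ 2) * Real.sqrt (∫ z, φ z * g (x - z) ^ 2) := by
  obtain ⟨hGm, hG0, hGb, hGs⟩ := envelope_admissible hg hC hsupp hφm hφ0 hφC hφs hφ1
  -- the right side is integrable (admissible envelope, shifted product)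
  have hIG : Integrable (fun x ↦ Real.sqrt (∫ z, φ z * g (x - ℓ - z) ^ 2) * Real.sqrt (∫ z, φ z * g (x - z) ^ 2)) := by
    have h := integrable_shift_mul_shift (a := a + h) hGm hGb hGs ℓ 0
    refine h.congr (Eventually.of_forall fun x ↦ ?_)
    simp only [sub_zero]
  -- the double integrand is integrable on the product
  have hC0 : 0 ≤ C := (abs_nonneg _).trans (hC 0)
  have hF : Integrable (fun p : ℝ × ℝ ↦ φ p.2 * (g (p.1 - ℓ - p.2) * g (p.1 - p.2))) (volume.prod volume) := by
    set B : Set (ℝ × ℝ) := Icc (-a - h) (a + h) ×ˢ Icc (-h) h with hB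
    have hBm : MeasurableSet B := measurableSet_Icc.prod measurableSet_Icc
    have hBfin : (volume.prod volume) B < ⊤ := by
      rw [hB, Measure.prod_prod, Real.volume_Icc, Real.volume_Icc]
      exact ENNReal.mul_lt_top ENNReal.ofReal_lt_top ENNReal.ofReal_lt_top
    have hint : Integrable (B.indicator fun _ : ℝ × ℝ ↦ Cφ * (C * C)) (volume.prod volume) :=
      (integrable_indicator_iff hBm).2 (integrableOn_const hBfin.ne)
    have hmeas : Measurable (fun p : ℝ × ℝ ↦ φ p.2 * (g (p.1 - ℓ - p.2) * g (p.1 - p.2))) :=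
      (hφm.comp measurable_snd).mul ((hg.comp ((measurable_fst.sub measurable_const).sub measurable_snd)).mul
        (hg.comp (measurable_fst.sub measurable_snd)))
    refine hint.mono' hmeas.aestronglyMeasurable (Eventually.of_forall fun p ↦ ?_)
    have hnn : 0 ≤ Cφ * (C * C) := mul_nonneg ((hφ0 0).trans (hφC 0)) (mul_nonneg hC0 hC0)
    by_cases hz : p.2 ∈ Icc (-h) h
    · by_cases hxz : p.1 - p.2 ∈ Icc (-a) a
      · have hp : p ∈ B := ⟨⟨by linarith [hxz.1, hz.1], by linarith [hxz.2, hz.2]⟩, hz⟩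
        rw [indicator_of_mem hp, Real.norm_eq_abs, abs_mul, abs_of_nonneg (hφ0 _), abs_mul]
        exact mul_le_mul (hφC _) (mul_le_mul (hC _) (hC _) (abs_nonneg _) hC0) (by positivity) ((hφ0 0).trans (hφC 0))
      · rw [hsupp _ hxz, mul_zero, mul_zero, norm_zero]
        by_cases hp : p ∈ B
        · rw [indicator_of_mem hp]; exact hnn
        · rw [indicator_of_notMem hp]
    · rw [hφs _ hz, zero_mul, norm_zero]
      by_cases hp : p ∈ B
      · rw [indicator_of_mem hp]; exact hnn
      · rw [indicator_of_notMem hp]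
  -- `∫ g(x−ℓ)g(x) = ∫∫ φ(z) g(x−ℓ−z) g(x−z) dz dx` (Fubini + translation invariance + `∫φ = 1`)
  have hlhs : ∫ x, g (x - ℓ) * g x = ∫ x, ∫ z, φ z * (g (x - ℓ - z) * g (x - z)) := by
    rw [integral_integral_swap hF]
    have h2 : ∀ z, ∫ x, φ z * (g (x - ℓ - z) * g (x - z)) = φ z * ∫ x, g (x - ℓ) * g x := by
      intro z
      rw [integral_const_mul]
      congr 1
      have := integral_sub_right_eq_self (μ := volume) (fun x ↦ g (x - ℓ) * g x) z
      rw [← this]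
      refine integral_congr_ae (Eventually.of_forall fun x ↦ ?_)
      simp only; ring_nf
    simp_rw [h2]
    rw [integral_mul_const, hφ1, one_mul]
  rw [hlhs]
  exact integral_mono hF.integral_prod_left hIG fun x ↦
    integral_weight_shift_mul_le_envelope_mul hg hC hφm hφ0 hφC hφs x ℓ

/-! ## §4 The prime-shift form of `g` is dominated by that of its envelope on the widened window -/

/-- **Envelope domination of the prime-shift form**: for an admissible `g` on `[−a, a]`, a weight `φ ≥ 0` on `[−h, h]` with `∫φ = 1`
(`h ≥ 0`) and the envelope `G = (φ ∗ g²)^{1/2}`: `Q_a(g) ≤ Q_{a+h}(G)`. -/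
theorem primeShiftForm_le_envelope (hh : 0 ≤ h) (hg : Measurable g) (hC : ∀ x, |g x| ≤ C)
    (hsupp : ∀ x, x ∉ Icc (-a) a → g x = 0)
    (hφm : Measurable φ) (hφ0 : ∀ z, 0 ≤ φ z) (hφC : ∀ z, φ z ≤ Cφ) (hφs : ∀ z, z ∉ Icc (-h) h → φ z = 0)
    (hφ1 : ∫ z, φ z = 1) :
    primeShiftForm a g ≤ primeShiftForm (a + h) (fun x ↦ Real.sqrt (∫ z, φ z * g (x - z) ^ 2)) := by
  obtain ⟨hGm, hG0, hGb, hGs⟩ := envelope_admissible hg hC hsupp hφm hφ0 hφC hφs hφ1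
  have hw0 : ∀ n : ℕ, 0 ≤ 2 * ((Λ n : ℝ) / Real.sqrt n) := fun n ↦
    mul_nonneg (by norm_num) (div_nonneg ArithmeticFunction.vonMangoldt_nonneg (Real.sqrt_nonneg _))
  unfold primeShiftForm
  calc ∑ n ∈ weilPrimeIndex a, 2 * ((Λ n : ℝ) / Real.sqrt n) * ∫ x, g (x - Real.log n) * g x
      ≤ ∑ n ∈ weilPrimeIndex a, 2 * ((Λ n : ℝ) / Real.sqrt n) *
          ∫ x, Real.sqrt (∫ z, φ z * g (x - Real.log n - z) ^ 2) * Real.sqrt (∫ z, φ z * g (x - z) ^ 2) := by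
        refine Finset.sum_le_sum fun n _ ↦ mul_le_mul_of_nonneg_left ?_ (hw0 n)
        exact integral_shift_mul_le_envelope hg hC hsupp hφm hφ0 hφC hφs hφ1 (Real.log n)
    _ ≤ ∑ n ∈ weilPrimeIndex (a + h), 2 * ((Λ n : ℝ) / Real.sqrt n) *
          ∫ x, Real.sqrt (∫ z, φ z * g (x - Real.log n - z) ^ 2) * Real.sqrt (∫ z, φ z * g (x - z) ^ 2) := by
        -- `weilPrimeIndex` is monotone in the window (tree: `stub_supBound_weilPrimeIndex_mono`, via `mem_weilPrimeIndex`)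
        have hsub : weilPrimeIndex a ⊆ weilPrimeIndex (a + h) := fun _ hn ↦
          mem_weilPrimeIndex.2 ((mem_weilPrimeIndex.1 hn).trans_le (by linarith))
        refine Finset.sum_le_sum_of_subset_of_nonneg hsub fun n _ _ ↦ ?_
        exact mul_nonneg (hw0 n) (integral_nonneg fun x ↦ mul_nonneg (Real.sqrt_nonneg _) (Real.sqrt_nonneg _))

/-- Hence the floor quotient of ANY admissible `g` (`∫g² > 0`) is at most the quotient of a NONNEGATIVE function on the widened window
with the small-scale regularity of the weight: `Q_a(g)/∫g² ≤ Q_{a+h}(G)/∫G²`, `∫G² = ∫g²`. -/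
theorem quotient_le_envelope_quotient (hh : 0 ≤ h) (hg : Measurable g) (hC : ∀ x, |g x| ≤ C)
    (hsupp : ∀ x, x ∉ Icc (-a) a → g x = 0) (hpos : 0 < ∫ x, g x ^ 2)
    (hφm : Measurable φ) (hφ0 : ∀ z, 0 ≤ φ z) (hφC : ∀ z, φ z ≤ Cφ) (hφs : ∀ z, z ∉ Icc (-h) h → φ z = 0)
    (hφ1 : ∫ z, φ z = 1) :
    primeShiftForm a g / ∫ x, g x ^ 2
      ≤ primeShiftForm (a + h) (fun x ↦ Real.sqrt (∫ z, φ z * g (x - z) ^ 2))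
          / ∫ x, Real.sqrt (∫ z, φ z * g (x - z) ^ 2) ^ 2 := by
  rw [integral_envelope_sq hg hC hsupp hφm hφ0 hφC hφs hφ1]
  exact div_le_div_of_nonneg_right (primeShiftForm_le_envelope hh hg hC hsupp hφm hφ0 hφC hφs hφ1) hpos.le

end FloorEnvelope

end Summit.RiemannHypothesis.RiemannHypothesis.Theorems.WeilFormatC
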